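import Literature.NumberTheory.DiophantineGeometry.GenEllConjugateAvoidance
import Mathlib.FieldTheory.Minpoly.Field
import HarnessLib

/-!
# [GenEll] Thm. 2.1, proof, Step "(ii) ⟹ (i)": the finite-subcover step for a family of maps with
# PERSISTENT sets and pole-protection

S. Mochizuki, *Arithmetic elliptic curves in general position*, Math. J. Okayama Univ. 52 (2010),
proof of Theorem 2.1, p. 12, with S. Mochizuki, *Noncritical Belyi maps*, Math. J. Okayama Univ. 46
(2004): a noncritical Belyi map can be chosen to avoid ("be noncritical at") any prescribed finite
set of ALGEBRAIC points, except for an unavoidable finite *persistent* set attached to the fixed part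
of the construction; transcendental points are never exceptional. [cite: MochizukiGenEll2010, Thm 2.1 proof p.12]

Abstract form proved here (`vojtaIneq_univ_of_persistent`), over the avoidance theorem of
`GenEllConjugateAvoidance`: fix a prime `p`, a degree `d`, the target `ε`, and finitely many "base
maps" `i : ι`, MORE THAN `2d` of them, with persistent sets the roots of pairwise coprime nonzero
rational polynomials `Pers i ∈ ℚ[X]`. Suppose that for every `i` and every nonzero `c ∈ ℚ[X]` coprime
to `Pers i` (the polynomial of the algebraic points to be protected) there is a mechanism whose bad set
is the set of roots (in `ℂ`, resp. `Q̄_p`) of a rational polynomial `g` COPRIME TO `c`, carrying the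
Vojta inequality in degree `≤ d` on the points all of whose conjugates are `r`-far from its bad set,
for every `r > 0`. Then `VojtaIneq Set.univ d ε`. The covering: the algebraic entries of a
configuration are roots of the product `c` of their minimal polynomials; by pigeonhole some `Pers i`
vanishes at none of them, so `c` is coprime to `Pers i`; the mechanism `(i, c)` then avoids every
algebraic entry (its `g` is coprime to `c`) and every transcendental entry (roots of `g ≠ 0` are
algebraic; `g = 0` has no roots).

Classical field theory and finite combinatorics (Mathlib), PROVED; theorems only; nothing here bears on
anything disputed.
-/

noncomputable section

open NumberField Set OnePoint Polynomial
open scoped Classical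

namespace Literature.NumberTheory.DiophantineGeometry.GenEll

/-! ## The polynomial of the algebraic entries of a configuration -/

/-- The rational polynomial attached to a point of `K ∪ {∞}` (`K` a field of characteristic `0`): the
minimal polynomial of an algebraic point, `1` for `∞` and for transcendental points.
(An auxiliary term written inline below as `OnePoint.elim`; this lemma records that it is nonzero.)
[cite: MochizukiGenEll2010, Thm 2.1 proof p.12] -/
theorem entryPoly_ne_zero {K : Type*} [Field K] [Algebra ℚ K] (ω : OnePoint K) :
    (ω.elim (1 : ℚ[X]) fun z => if IsIntegral ℚ z then minpoly ℚ z else 1) ≠ 0 := by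
  induction ω using OnePoint.rec with
  | infty => simp
  | coe z =>
    simp only [OnePoint.elim_some]
    split_ifs with hz
    · exact minpoly.ne_zero hz
    · exact one_ne_zero

/-- The polynomial of a point is coprime to any rational polynomial `P ≠ 0` of which the point is
not a root. [cite: MochizukiGenEll2010, Thm 2.1 proof p.12] -/
theorem isCoprime_entryPoly_of_forall_ne {K : Type*} [Field K] [Algebra ℚ K] {P : ℚ[X]}
    (hP : P ≠ 0) (ω : OnePoint K) (hω : ∀ w ∈ P.aroots K, ω ≠ ↑w) :
    IsCoprime (ω.elim (1 : ℚ[X]) fun z => if IsIntegral ℚ z then minpoly ℚ z else 1) P := by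
  induction ω using OnePoint.rec with
  | infty => simpa using isCoprime_one_left
  | coe z =>
    simp only [OnePoint.elim_some]
    split_ifs with hz
    · rw [(minpoly.irreducible hz).coprime_iff_not_dvd]
      intro hdvd
      have hroot : aeval z P = 0 := by
        obtain ⟨q, hq⟩ := hdvd
        rw [hq, map_mul, minpoly.aeval, zero_mul]
      exact hω z (by rw [Polynomial.mem_aroots]; exact ⟨hP, hroot⟩) rfl
    · exact isCoprime_one_left

/-- A root of a polynomial `g` coprime to the polynomial of a point is different from that point
(roots of `g ≠ 0` are algebraic, and the minimal polynomial of such a root divides `g`; `g = 0` has no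
recorded roots). [cite: MochizukiGenEll2010, Thm 2.1 proof p.12] -/
theorem ne_of_mem_aroots_of_isCoprime_entryPoly {K : Type*} [Field K] [Algebra ℚ K] {g : ℚ[X]}
    (ω : OnePoint K)
    (hg : IsCoprime g (ω.elim (1 : ℚ[X]) fun z => if IsIntegral ℚ z then minpoly ℚ z else 1))
    {w : K} (hw : w ∈ g.aroots K) : ω ≠ ↑w := by
  intro hωw
  subst hωw
  rw [Polynomial.mem_aroots] at hw
  have halg : IsAlgebraic ℚ w := ⟨g, hw.1, hw.2⟩
  have hint : IsIntegral ℚ w := halg.isIntegral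
  rw [OnePoint.elim_some, if_pos hint] at hg
  have hunit : IsUnit (minpoly ℚ w) :=
    hg.isUnit_of_dvd' (minpoly.dvd ℚ w hw.2) dvd_rfl
  exact minpoly.not_isUnit ℚ w hunit

/-! ## The finite-subcover step for a persistent family -/

/-- **Vojta in degree `≤ d` from a family of maps with pairwise coprime PERSISTENT polynomials and
pole-protection of arbitrary algebraic sets.** Fix a prime `p`, a degree `d`, the target `ε`, and
finitely many base indices `i : ι`, more than `2d` of them, with nonzero pairwise coprime persistent
polynomials `Pers i ∈ ℚ[X]` (their roots, at `∞` and at `p`, are the points NO mechanism over `i` can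
avoid). Suppose that for every `i` and every nonzero `c ∈ ℚ[X]` coprime to `Pers i` there is a rational
polynomial `g` COPRIME TO `c` such that, for every margin `r > 0`, the Vojta inequality
`ht ≲ (1+ε)(log-diff + log-cond)` holds in degree `≤ d` on the points all of whose complex conjugates are
`r`-far from the complex roots of `g` and all of whose `Q̄_p`-conjugates are `r`-far from its `Q̄_p`-roots
(the mechanism "base map `i`, protecting the roots of `c`", with bad set the roots of `g`). Then the
Vojta inequality holds on all of `U_P(Q̄)^{≤ d}`: `VojtaIneq Set.univ d ε`.
[cite: MochizukiGenEll2010, Thm 2.1 proof p.12] -/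
theorem vojtaIneq_univ_of_persistent (p : ℕ) [Fact p.Prime] (d : ℕ) {ε : ℝ} {ι : Type*}
    [Fintype ι] (Pers : ι → ℚ[X]) (hPers0 : ∀ i, Pers i ≠ 0)
    (hPcop : Pairwise fun i j => IsCoprime (Pers i) (Pers j))
    (hcard : 2 * d < Fintype.card ι)
    (hmech : ∀ i (c : ℚ[X]), c ≠ 0 → IsCoprime c (Pers i) → ∃ g : ℚ[X], IsCoprime g c ∧
      ∀ r : ℝ, 0 < r → VojtaIneq {P : NFPoint |
        (∀ σ : P.F →+* ℂ, ∀ a ∈ g.aroots ℂ, r < ‖σ P.x - a‖) ∧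
        (∀ σ : P.F →+* PadicAlgCl p, ∀ a ∈ g.aroots (PadicAlgCl p), r < ‖σ P.x - a‖)} d ε) :
    VojtaIneq Set.univ d ε := by
  classical
  choose g hgc hgV using hmech
  -- mechanisms: a base index together with an admissible protection polynomial
  let κ := Σ i : ι, {c : ℚ[X] // c ≠ 0 ∧ IsCoprime c (Pers i)}
  let G : κ → ℚ[X] := fun k => g k.1 k.2.1 k.2.2.1 k.2.2.2
  refine vojtaIneq_univ_of_avoidance p d (κ := κ) (fun k => ((G k).aroots ℂ).toFinset)
    (fun k => ((G k).aroots (PadicAlgCl p)).toFinset) ?_ ?_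
  · -- the Vojta inequality on each margin set (multiset ↔ finset membership)
    intro k r hr
    have hset : {P : NFPoint |
          (∀ σ : P.F →+* ℂ, ∀ a ∈ ((G k).aroots ℂ).toFinset, r < ‖σ P.x - a‖) ∧
          (∀ σ : P.F →+* PadicAlgCl p, ∀ a ∈ ((G k).aroots (PadicAlgCl p)).toFinset,
            r < ‖σ P.x - a‖)} =
        {P : NFPoint |
          (∀ σ : P.F →+* ℂ, ∀ a ∈ (G k).aroots ℂ, r < ‖σ P.x - a‖) ∧
          (∀ σ : P.F →+* PadicAlgCl p, ∀ a ∈ (G k).aroots (PadicAlgCl p), r < ‖σ P.x - a‖)} := by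
      ext P
      simp only [Set.mem_setOf_eq, Multiset.mem_toFinset]
    rw [hset]
    exact hgV k.1 k.2.1 k.2.2.1 k.2.2.2 r hr
  · -- exact avoidance of every configuration
    intro a b
    -- pigeonhole: a base index whose persistent set contains no entry
    obtain ⟨i, hai, hbi⟩ := exists_avoid_of_pairwiseDisjoint p d
      (fun i => ((Pers i).aroots ℂ).toFinset) (fun i => ((Pers i).aroots (PadicAlgCl p)).toFinset)
      (fun i j hij => disjoint_aroots_toFinset_of_isCoprime (hPcop hij))
      (fun i j hij => disjoint_aroots_toFinset_of_isCoprime (hPcop hij)) hcard a b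
    -- the polynomial of the algebraic entries
    let eA : Fin d → ℚ[X] := fun j =>
      (a j).elim (1 : ℚ[X]) fun z => if IsIntegral ℚ z then minpoly ℚ z else 1
    let eB : Fin d → ℚ[X] := fun j =>
      (b j).elim (1 : ℚ[X]) fun z => if IsIntegral ℚ z then minpoly ℚ z else 1
    let c : ℚ[X] := (∏ j, eA j) * ∏ j, eB j
    have hc0 : c ≠ 0 :=
      mul_ne_zero (Finset.prod_ne_zero_iff.mpr fun j _ => entryPoly_ne_zero (a j))
        (Finset.prod_ne_zero_iff.mpr fun j _ => entryPoly_ne_zero (b j))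
    have hcP : IsCoprime c (Pers i) := by
      refine IsCoprime.mul_left ?_ ?_
      · exact IsCoprime.prod_left fun j _ =>
          isCoprime_entryPoly_of_forall_ne (hPers0 i) (a j)
            (fun w hw => hai j w (Multiset.mem_toFinset.mpr hw))
      · exact IsCoprime.prod_left fun j _ =>
          isCoprime_entryPoly_of_forall_ne (hPers0 i) (b j)
            (fun w hw => hbi j w (Multiset.mem_toFinset.mpr hw))
    have hA : ∀ j, eA j ∣ c := fun j =>
      (Finset.dvd_prod_of_mem eA (Finset.mem_univ j)).mul_right _
    have hB : ∀ j, eB j ∣ c := fun j =>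
      (Finset.dvd_prod_of_mem eB (Finset.mem_univ j)).mul_left _
    refine ⟨⟨i, c, hc0, hcP⟩, fun j w hw => ?_, fun j w hw => ?_⟩
    · exact ne_of_mem_aroots_of_isCoprime_entryPoly (a j)
        ((hgc i c hc0 hcP).of_isCoprime_of_dvd_right (hA j)) (Multiset.mem_toFinset.mp hw)
    · exact ne_of_mem_aroots_of_isCoprime_entryPoly (b j)
        ((hgc i c hc0 hcP).of_isCoprime_of_dvd_right (hB j)) (Multiset.mem_toFinset.mp hw)

end Literature.NumberTheory.DiophantineGeometry.GenEll

end
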